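import Summits.HodgeConjecture.CorCM.Census.QuarticTwistResidualStructure
import Mathlib.Tactic.Module

/-!
# The quartic twist `(ℤ/4 × B, (2,0))`, VI: the CLOSING FACES at the equator — the column face at a Boolean half-type reduces to a
# Boolean pair difference `X`, the equatorial square to `Σ_{q∈Q} X_{0,q} − w_1` (`|B|` odd)

COR-CM (cell `pub-hodgecm2`), count-neutral kernel combinatorics by the binder seat b09 (gen 32; lane QUARTIC-TWIST), part VI, sequel of
`Census/QuarticTwistResidualStructure.lean`.  Theorems + one bookkeeping definition (`prof`, the equatorial profile types); no `decide`
table, no certificate, no named fact, no geometry, no `sorry`.  HONEST FRAMING: `HC_CM` is NOT proved; nothing here is a headline or a period.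

SETTING: `|B| = 2m + 1`, `Q ⊆ B` with `|Q| = m`, `i ≠ j` outside `Q`.  The PROFILE type `prof Q i x` is `1` on `Q`, `x` at `i`, `0` elsewhere;
`prof Q i 0 = 𝟙_Q` is the Boolean half-type.  §1: its Lee potentials and regimes — `𝟙_Q` and `𝟙_Q − δ_i` have regime `0`, `𝟙_{Q+i}`,
`𝟙_Q + 2δ_i`, `𝟙_{Q+j}`, `𝟙_{Q+i+j}` have regime `1` (the equator is crossed between `|Q| = m` and `m + 1`; no ties since `|B|` is odd).
§2: the affine forms of two types of the same regime differing in one column differ by two atoms (`affine_sub_affine`); the affine form of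
a profile type (`affine_prof`).  §3 THE TWO CLOSING IDENTITIES: with `A = affine ∘ reg` (part III),
* `closing_column`: `A(𝟙_Q) − A(𝟙_{Q+i}) − A(𝟙_Q − δ_i) + A(𝟙_Q + 2δ_i) = X_{1,i} + pair(0) − pair(−δ_i)` — the four corners of the
  COLUMN FACE at `𝟙_Q` in the column `i` sit in the regimes `0, 1, 0, 1`;
* `closing_square`: `A(𝟙_Q) − A(𝟙_{Q+i}) − A(𝟙_{Q+j}) + A(𝟙_{Q+i+j}) = Σ_{q∈Q} X_{0,q} − w_1` — the EQUATORIAL SQUARE.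
Part VI (`Census/QuarticTwistGenerate.lean`) turns these into `X, w ∈ pairs ⊔ ℤ[G]·S` and closes the generation theorem.  All [folklore].

## References
* [Pohlmann1968] H. Pohlmann, Algebraic cycles on abelian varieties of complex multiplication type, Ann. of Math. 88 (1968), Thm 1.
-/

namespace Summit.HodgeConjecture.CorCM.Census.QuarticTwist

open Finset

variable (B : Type) [AddGroup B] [Fintype B] [DecidableEq B]

/-! ## §1 Profile types, their potentials and regimes -/

/-- **The profile type** `prof Q i x`: `1` on `Q`, `x` at `i`, `0` elsewhere. [folklore] -/
def prof (Q : Finset B) (i : B) (x : ZMod 4) : Ty B := fun b => if b ∈ Q then 1 else if b = i then x else 0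

omit [AddGroup B] [Fintype B] in
/-- Value on `Q`. [folklore] -/
theorem prof_apply_of_mem (Q : Finset B) (i : B) (x : ZMod 4) {b : B} (hb : b ∈ Q) : prof B Q i x b = 1 := by
  simp [prof, hb]

omit [AddGroup B] [Fintype B] in
/-- Value at `i ∉ Q`. [folklore] -/
theorem prof_apply_self (Q : Finset B) {i : B} (hi : i ∉ Q) (x : ZMod 4) : prof B Q i x i = x := by
  simp [prof, hi]

omit [AddGroup B] [Fintype B] in
/-- Value elsewhere. [folklore] -/
theorem prof_apply_of_not_mem (Q : Finset B) {i : B} (x : ZMod 4) {b : B} (hb : b ∉ Q) (hbi : b ≠ i) : prof B Q i x b = 0 := by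
  simp [prof, hb, hbi]

omit [AddGroup B] [Fintype B] in
/-- Adding a value at `i`: `prof Q i x + k·δ_i = prof Q i (x + k)`. [folklore] -/
theorem prof_add_single_self (Q : Finset B) {i : B} (hi : i ∉ Q) (x k : ZMod 4) :
    prof B Q i x + Pi.single i k = prof B Q i (x + k) := by
  funext b
  simp only [Pi.add_apply, prof, Pi.single_apply]
  by_cases hb : b ∈ Q
  · rw [if_pos hb, if_pos hb, if_neg (ne_of_mem_of_not_mem hb hi), add_zero]
  · rw [if_neg hb, if_neg hb]
    by_cases hbi : b = i
    · rw [if_pos hbi, if_pos hbi, if_pos hbi]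
    · rw [if_neg hbi, if_neg hbi, if_neg hbi, add_zero]

omit [AddGroup B] [Fintype B] in
/-- Adding `1` at a new column `j`: `prof Q i x + δ_j = prof (Q ∪ {j}) i x` (`j ∉ Q`, `j ≠ i`). [folklore] -/
theorem prof_add_single_other (Q : Finset B) (i : B) (x : ZMod 4) {j : B} (hj : j ∉ Q) (hji : j ≠ i) :
    prof B Q i x + Pi.single j 1 = prof B (insert j Q) i x := by
  funext b
  simp only [Pi.add_apply, prof, Pi.single_apply, mem_insert]
  by_cases hbj : b = j
  · subst hbj
    rw [if_neg hj, if_neg hji, if_pos rfl, if_pos (Or.inl rfl), zero_add]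
  · rw [if_neg hbj, add_zero]
    by_cases hb : b ∈ Q
    · rw [if_pos hb, if_pos (Or.inr hb)]
    · rw [if_neg hb, if_neg (not_or.mpr ⟨hbj, hb⟩)]

/-- `step 0 0 = 1`, `step 1 0 = −1`, `step 0 1 = −1`... the steps at the values `0` and `1`. [folklore] -/
theorem step_zero_zero : step 0 0 = 1 ∧ step 1 0 = -1 ∧ step 0 1 = -1 ∧ step 1 1 = 1 := by
  refine ⟨?_, ?_, ?_, ?_⟩ <;> decide

omit [AddGroup B] [Fintype B] in
/-- The four corners of the COLUMN FACE at `𝟙_Q` in the column `i` and of the EQUATORIAL SQUARE at `𝟙_Q` in the columns `i, j`.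
[folklore] -/
theorem corners (Q : Finset B) {i j : B} (hi : i ∉ Q) (hj : j ∉ Q) (hji : j ≠ i) :
    flip B (0, i) (prof B Q i 0) = prof B Q i 1 ∧ flip B (1, i) (prof B Q i 0) = prof B Q i (-1) ∧
      flip B (1, i) (flip B (0, i) (prof B Q i 0)) = prof B Q i 2 ∧ flip B (0, j) (prof B Q i 0) = prof B (insert j Q) i 0 ∧
      flip B (0, j) (flip B (0, i) (prof B Q i 0)) = prof B (insert j Q) i 1 := by
  obtain ⟨s00, s10, -, -⟩ := step_zero_zero
  refine ⟨?_, ?_, ?_, ?_, ?_⟩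
  · rw [flip_eq_add_single, prof_apply_self B Q hi, s00, prof_add_single_self B Q hi, zero_add]
  · rw [flip_eq_add_single, prof_apply_self B Q hi, s10, prof_add_single_self B Q hi, zero_add]
  · rw [show ((1 : ZMod 2), i) = ((0 : ZMod 2) + 1, i) by rw [zero_add], flip_flip_same, prof_add_single_self B Q hi, zero_add]
  · rw [flip_eq_add_single, prof_apply_of_not_mem B Q 0 hj hji, s00, prof_add_single_other B Q i 0 hj hji]
  · rw [flip_eq_add_single B (0, i), prof_apply_self B Q hi, s00, prof_add_single_self B Q hi, zero_add, flip_eq_add_single,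
      prof_apply_of_not_mem B Q 1 hj hji, s00, prof_add_single_other B Q i 1 hj hji]

/-- The Lee weight of a difference, as a table. [folklore] -/
theorem lee_sub (x u : ZMod 4) : lee (x - u) = if x = u then 0 else if x = u + 2 then 2 else 1 := by
  revert x u; decide

omit [AddGroup B] in
/-- **The Lee potentials of a profile type**: `L u (prof Q i x) = |Q|·Lee(1−u) + Lee(x−u) + (|B| − |Q| − 1)·Lee(−u)` (`i ∉ Q`). [folklore] -/
theorem L_prof (Q : Finset B) {i : B} (hi : i ∉ Q) (x u : ZMod 4) :
    L B u (prof B Q i x) = Q.card * lee (1 - u) + lee (x - u) + (Fintype.card B - Q.card - 1) * lee (0 - u) := by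
  rw [L_eq_add_erase B u _ i, prof_apply_self B Q hi]
  have hQsub : Q ⊆ univ.erase i := fun b hb => mem_erase.mpr ⟨fun h => hi (h ▸ hb), mem_univ b⟩
  rw [← Finset.sum_sdiff hQsub]
  have h1 : ∑ b ∈ univ.erase i \ Q, lee (prof B Q i x b - u) = (Fintype.card B - Q.card - 1) * lee (0 - u) := by
    have : ∀ b ∈ univ.erase i \ Q, lee (prof B Q i x b - u) = lee (0 - u) := by
      intro b hb
      rw [mem_sdiff, mem_erase] at hb
      rw [prof_apply_of_not_mem B Q x hb.2 hb.1.1]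
    rw [Finset.sum_congr rfl this, Finset.sum_const, smul_eq_mul, Finset.card_sdiff_of_subset hQsub,
      Finset.card_erase_of_mem (mem_univ i), Finset.card_univ]
    congr 1
    omega
  have h2 : ∑ b ∈ Q, lee (prof B Q i x b - u) = Q.card * lee (1 - u) := by
    have : ∀ b ∈ Q, lee (prof B Q i x b - u) = lee (1 - u) := fun b hb => by rw [prof_apply_of_mem B Q i x hb]
    rw [Finset.sum_congr rfl this, Finset.sum_const, smul_eq_mul]
  rw [h1, h2]
  ring

omit [AddGroup B] [DecidableEq B] in
/-- A regime that minimises all `L u'` is THE regime (`|B|` odd). [folklore] -/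
theorem reg_eq_of_forall_le (hB : Odd (Fintype.card B)) {s : Ty B} {u : ZMod 4} (h : ∀ u', L B u s ≤ L B u' s) : reg B s = u := by
  symm
  refine eq_reg_of_L_eq B hB (le_antisymm ?_ (Phi_le B u s))
  obtain ⟨u', hu'⟩ := exists_L_eq_Phi B s
  rw [← hu']
  exact h u'

omit [AddGroup B] in
/-- **Regimes of the six corner types** (`|B| = 2m+1`, `|Q| = m ≥ 1`, `i ≠ j` outside `Q`): `𝟙_Q ↦ 0`, `𝟙_{Q+i} ↦ 1`, `𝟙_Q − δ_i ↦ 0`,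
`𝟙_Q + 2δ_i ↦ 1`, `𝟙_{Q+j} ↦ 1`, `𝟙_{Q+i+j} ↦ 1`. [folklore] -/
theorem reg_corners (hB : Odd (Fintype.card B)) {m : ℕ} (hm : Fintype.card B = 2 * m + 1) (h1 : 1 ≤ m) (Q : Finset B) (hQ : Q.card = m)
    {i j : B} (hi : i ∉ Q) (hj : j ∉ Q) (hji : j ≠ i) :
    reg B (prof B Q i 0) = 0 ∧ reg B (prof B Q i 1) = 1 ∧ reg B (prof B Q i (-1)) = 0 ∧ reg B (prof B Q i 2) = 1 ∧
      reg B (prof B (insert j Q) i 0) = 1 ∧ reg B (prof B (insert j Q) i 1) = 1 := by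
  have hi' : i ∉ insert j Q := fun h => (mem_insert.mp h).elim (fun h => hji h.symm) hi
  have hQ' : (insert j Q).card = m + 1 := by rw [card_insert_of_notMem hj, hQ]
  have key : ∀ u : ZMod 4, u = 0 ∨ u = 1 ∨ u = 2 ∨ u = 3 := by decide
  have z4 : ((-1 : ZMod 4) = 3 ∧ lee 0 = 0 ∧ lee 1 = 1 ∧ lee 2 = 2 ∧ lee 3 = 1) ∧
      ((1 : ZMod 4) - 0 = 1 ∧ (1 : ZMod 4) - 1 = 0 ∧ (1 : ZMod 4) - 2 = 3 ∧ (1 : ZMod 4) - 3 = 2 ∧ (0 : ZMod 4) - 0 = 0 ∧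
        (0 : ZMod 4) - 1 = 3 ∧ (0 : ZMod 4) - 2 = 2 ∧ (0 : ZMod 4) - 3 = 1) ∧
      ((2 : ZMod 4) - 0 = 2 ∧ (2 : ZMod 4) - 1 = 1 ∧ (2 : ZMod 4) - 2 = 0 ∧ (2 : ZMod 4) - 3 = 3 ∧ (3 : ZMod 4) - 0 = 3 ∧
        (3 : ZMod 4) - 1 = 2 ∧ (3 : ZMod 4) - 2 = 1 ∧ (3 : ZMod 4) - 3 = 0) := by decide
  -- each regime: compare the four potentials given by `L_prof`
  have tac : ∀ (Q : Finset B) (a : ℕ), Q.card = a → i ∉ Q → ∀ (x u : ZMod 4),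
      (∀ u', a * lee (1 - u) + lee (x - u) + (Fintype.card B - a - 1) * lee (0 - u)
        ≤ a * lee (1 - u') + lee (x - u') + (Fintype.card B - a - 1) * lee (0 - u')) → reg B (prof B Q i x) = u := by
    intro Q a ha hiQ x u h
    refine reg_eq_of_forall_le B hB fun u' => ?_
    rw [L_prof B Q hiQ, L_prof B Q hiQ, ha]
    exact h u'
  refine ⟨tac Q m hQ hi 0 0 ?_, tac Q m hQ hi 1 1 ?_, tac Q m hQ hi (-1) 0 ?_, tac Q m hQ hi 2 1 ?_,
    tac _ (m + 1) hQ' hi' 0 1 ?_, tac _ (m + 1) hQ' hi' 1 1 ?_⟩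
  all_goals
    intro u'
    rcases key u' with rfl | rfl | rfl | rfl <;> simp only [z4] <;> omega

/-! ## §2 Affine forms of neighbouring types and of profile types -/

omit [AddGroup B] in
/-- **Two types of the same regime that differ in one column have affine forms differing by two atoms.** [folklore] -/
theorem affine_sub_affine (u : ZMod 4) {s s' : Ty B} (i : B) (h : ∀ b, b ≠ i → s b = s' b) :
    affine B u s - affine B u s' = atomVec B u s i - atomVec B u s' i := by
  unfold affine
  rw [← Finset.add_sum_erase _ _ (mem_univ i), ← Finset.add_sum_erase _ (atomVec B u s') (mem_univ i)]
  have hrest : ∑ x ∈ univ.erase i, atomVec B u s x = ∑ x ∈ univ.erase i, atomVec B u s' x :=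
    Finset.sum_congr rfl fun x hx => atomVec_congr B u (h x (ne_of_mem_erase hx))
  rw [hrest]; abel

omit [AddGroup B] in
/-- **The affine form of a profile type**: the atoms over `Q`, the atom at `i`, the atoms over the rest, and the mass correction. [folklore] -/
theorem affine_prof (u : ZMod 4) (Q : Finset B) {i : B} (hi : i ∉ Q) (x : ZMod 4) :
    affine B u (prof B Q i x) = (∑ b ∈ Q, Pi.single (atom B u b (1 - u)) (1 : ℤ)) + Pi.single (atom B u i (x - u)) 1
      + (∑ b ∈ univ \ insert i Q, Pi.single (atom B u b (0 - u)) (1 : ℤ)) - ((Fintype.card B : ℤ) - 1) • Pi.single (cst B u) 1 := by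
  unfold affine
  rw [← Finset.add_sum_erase _ _ (mem_univ i)]
  have hQsub : Q ⊆ univ.erase i := fun b hb => mem_erase.mpr ⟨fun h => hi (h ▸ hb), mem_univ b⟩
  rw [← Finset.sum_sdiff hQsub]
  have hsd : univ.erase i \ Q = univ \ insert i Q := by
    ext b; simp only [mem_sdiff, mem_erase, mem_univ, and_true, mem_insert, not_or, true_and]
  have hi_term : atomVec B u (prof B Q i x) i = Pi.single (atom B u i (x - u)) 1 := by
    unfold atomVec; rw [prof_apply_self B Q hi]
  have hQ_term : ∑ b ∈ Q, atomVec B u (prof B Q i x) b = ∑ b ∈ Q, Pi.single (atom B u b (1 - u)) (1 : ℤ) :=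
    Finset.sum_congr rfl fun b hb => by unfold atomVec; rw [prof_apply_of_mem B Q i x hb]
  have hR_term : ∑ b ∈ univ.erase i \ Q, atomVec B u (prof B Q i x) b = ∑ b ∈ univ \ insert i Q, Pi.single (atom B u b (0 - u)) (1 : ℤ) := by
    rw [hsd]
    refine Finset.sum_congr rfl fun b hb => ?_
    have hb' : b ∉ Q ∧ b ≠ i := by
      simp only [mem_sdiff, mem_univ, mem_insert, not_or, true_and] at hb; exact ⟨hb.2, hb.1⟩
    unfold atomVec; rw [prof_apply_of_not_mem B Q x hb'.1 hb'.2]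
  rw [hi_term, hQ_term, hR_term]
  abel

/-! ## §3 The two closing identities -/

omit [AddGroup B] in
/-- **CLOSING IDENTITY I (column face at `𝟙_Q` in the column `i`).**  With the regimes `0, 1, 0, 1` of the four corners,
`A(𝟙_Q) − A(𝟙_{Q+i}) − A(𝟙_Q − δ_i) + A(𝟙_Q + 2δ_i) = X_{1,i} + pair(0) − pair(−δ_i)`. [folklore] -/
theorem closing_column (Q : Finset B) {i : B} (hi : i ∉ Q) :
    affine B 0 (prof B Q i 0) - affine B 1 (prof B Q i 1) - affine B 0 (prof B Q i (-1)) + affine B 1 (prof B Q i 2)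
      = Xvec B 1 i + pairVec B (cst B 0) - pairVec B (atom B 0 i (-1)) := by
  have hA : affine B 0 (prof B Q i 0) - affine B 0 (prof B Q i (-1)) = Pi.single (cst B 0) 1 - Pi.single (atom B 0 i (-1)) 1 := by
    rw [affine_sub_affine B 0 i (fun b hb => by simp [prof, hb])]
    unfold atomVec
    rw [prof_apply_self B Q hi, prof_apply_self B Q hi, sub_zero, atom_zero, sub_zero]
  have hB' : affine B 1 (prof B Q i 2) - affine B 1 (prof B Q i 1) = Pi.single (atom B 1 i 1) 1 - Pi.single (cst B 1) 1 := by
    rw [affine_sub_affine B 1 i (fun b hb => by simp [prof, hb])]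
    unfold atomVec
    rw [prof_apply_self B Q hi, prof_apply_self B Q hi, show (2 : ZMod 4) - 1 = 1 by decide, sub_self, atom_zero]
  have e : affine B 0 (prof B Q i 0) - affine B 1 (prof B Q i 1) - affine B 0 (prof B Q i (-1)) + affine B 1 (prof B Q i 2)
      = (affine B 0 (prof B Q i 0) - affine B 0 (prof B Q i (-1))) + (affine B 1 (prof B Q i 2) - affine B 1 (prof B Q i 1)) := by abel
  rw [e, hA, hB']
  unfold Xvec pairVec
  rw [cst_add_two, atom_add_two, show (0 : ZMod 4) + 2 = 2 by decide, show (1 : ZMod 4) + 1 = 2 by decide]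
  abel

omit [AddGroup B] in
/-- **CLOSING IDENTITY II (equatorial square at `𝟙_Q` in the columns `i ≠ j`).**  For ANY `Q` and `i ≠ j` outside `Q`, reading the corners
`𝟙_Q, 𝟙_{Q+i}, 𝟙_{Q+j}, 𝟙_{Q+i+j}` in the regimes `0, 1, 1, 1`:
`A(𝟙_Q) − A(𝟙_{Q+i}) − A(𝟙_{Q+j}) + A(𝟙_{Q+i+j}) = Σ_{q∈Q} X_{0,q} − w_1` (an identity of the affine forms, no parity needed). [folklore] -/
theorem closing_square (Q : Finset B) {i j : B} (hi : i ∉ Q) (hj : j ∉ Q) (hji : j ≠ i) :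
    affine B 0 (prof B Q i 0) - affine B 1 (prof B Q i 1) - affine B 1 (prof B (insert j Q) i 0) + affine B 1 (prof B (insert j Q) i 1)
      = (∑ q ∈ Q, Xvec B 0 q) - Wvec B 1 := by
  have hi' : i ∉ insert j Q := fun h => (mem_insert.mp h).elim (fun h => hji h.symm) hi
  -- the two corners of regime `1` differing at `j`
  have hD : affine B 1 (prof B (insert j Q) i 1) - affine B 1 (prof B Q i 1) = Pi.single (cst B 1) 1 - Pi.single (atom B 1 j (-1)) 1 := by
    rw [affine_sub_affine B 1 j (fun b hb => ?_)]
    · unfold atomVec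
      rw [prof_apply_of_mem B _ i 1 (mem_insert_self j Q), prof_apply_of_not_mem B Q 1 hj hji, sub_self, atom_zero, zero_sub]
    · simp only [prof, mem_insert]
      by_cases hbQ : b ∈ Q
      · rw [if_pos (Or.inr hbQ), if_pos hbQ]
      · rw [if_neg (fun h => h.elim hb hbQ), if_neg hbQ]
  -- the two expansions
  have hT1 := affine_prof B 0 Q hi 0
  have hCj := affine_prof B 1 (insert j Q) hi' 0
  -- splitting the `(−1)`-atoms: `univ = Q ⊔ (univ \ Q)`, `univ \ Q ∋ i, j`, rest `R' = univ \ insert i (insert j Q)`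
  set R' : Finset B := univ \ insert i (insert j Q) with hR'
  have hsplit1 : (∑ b, Pi.single (atom B 1 b (-1)) (1 : ℤ) : Ty B → ℤ)
      = (∑ b ∈ Q, Pi.single (atom B 1 b (-1)) (1 : ℤ) : Ty B → ℤ) + ∑ b ∈ univ \ Q, (Pi.single (atom B 1 b (-1)) (1 : ℤ) : Ty B → ℤ) := by
    rw [← Finset.sum_add_sum_compl Q, Finset.compl_eq_univ_sdiff]
  have hiQ : i ∈ univ \ Q := mem_sdiff.mpr ⟨mem_univ i, hi⟩
  have hjQ : j ∈ (univ \ Q).erase i := mem_erase.mpr ⟨hji, mem_sdiff.mpr ⟨mem_univ j, hj⟩⟩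
  have hR'eq : ((univ \ Q).erase i).erase j = R' := by
    ext b; simp only [hR', mem_erase, mem_sdiff, mem_univ, true_and, mem_insert, not_or]; tauto
  have hsplit2 : ∑ b ∈ univ \ Q, (Pi.single (atom B 1 b (-1)) (1 : ℤ) : Ty B → ℤ)
      = (Pi.single (atom B 1 i (-1)) (1 : ℤ) : Ty B → ℤ) + Pi.single (atom B 1 j (-1)) (1 : ℤ)
        + ∑ b ∈ R', (Pi.single (atom B 1 b (-1)) (1 : ℤ) : Ty B → ℤ) := by
    rw [← Finset.add_sum_erase _ _ hiQ, ← Finset.add_sum_erase _ _ hjQ, hR'eq, add_assoc]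
  -- cardinalities: `|univ ∖ (Q + i)| + |Q| + 1 = |B|`, `|Q + j| = |Q| + 1`
  have hle : Q.card + 1 ≤ Fintype.card B := by
    have := Finset.card_le_univ (insert i Q); rw [card_insert_of_notMem hi] at this; exact this
  have hcardR : ((univ \ insert i Q).card : ℤ) = (Fintype.card B : ℤ) - Q.card - 1 := by
    rw [Finset.card_sdiff_of_subset (subset_univ _), Finset.card_univ, card_insert_of_notMem hi, Nat.cast_sub hle]; push_cast; ring
  have hcardQ' : (insert j Q).card = Q.card + 1 := by rw [card_insert_of_notMem hj]
  -- rewrite everything in common atoms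
  have e : affine B 0 (prof B Q i 0) - affine B 1 (prof B Q i 1) - affine B 1 (prof B (insert j Q) i 0) + affine B 1 (prof B (insert j Q) i 1)
      = affine B 0 (prof B Q i 0) - affine B 1 (prof B (insert j Q) i 0) + (affine B 1 (prof B (insert j Q) i 1) - affine B 1 (prof B Q i 1)) := by
    abel
  rw [e, hD, hT1, hCj]
  simp only [sub_zero, sub_self, atom_zero, zero_sub, Finset.sum_const, hcardQ']
  unfold Wvec Xvec
  rw [hsplit1, hsplit2, show (1 : ZMod 4) - 1 = 0 by decide]
  simp only [zero_add, Finset.sum_sub_distrib, Finset.sum_add_distrib, Finset.sum_const]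
  simp only [← natCast_zsmul]
  push_cast
  rw [hcardR]
  module

end Summit.HodgeConjecture.CorCM.Census.QuarticTwist
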